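import Summits.CriticalPhenomena.PercolationContinuityZ3.Theorems.Transplant.SkelFrmFrom1ParamsLBL
import Summits.CriticalPhenomena.PercolationContinuityZ3.Theorems.Transplant.SkelFrm1ParamsLBL
import Summits.CriticalPhenomena.PercolationContinuityZ3.Theorems.Transplant.SkelNeg1ParamsL
import Summits.CriticalPhenomena.PercolationContinuityZ3.Theorems.Transplant.SkelNegParamsFine
import Summits.CriticalPhenomena.PercolationContinuityZ3.Theorems.Transplant.TwoAxisParaCellsFineRep
import Summits.CriticalPhenomena.PercolationContinuityZ3.Theorems.Transplant.SkelNeg1ParamsLF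
import Summits.CriticalPhenomena.PercolationContinuityZ3.Theorems.Transplant.PlanarSkeletonFrmFromDefs
import Summits.CriticalPhenomena.PercolationContinuityZ3.Theorems.Transplant.PlanarSkeletonFrmDefs
import Summits.CriticalPhenomena.PercolationContinuityZ3.Theorems.Transplant.SkelPhiStepIDataNS
import HarnessLib
import Summits.CriticalPhenomena.PercolationContinuityZ3.Theorems.Transplant.SkelFrm1ParamsLF
/-!
# U-WAVE PORT (RULING D-U, lead g21 2026-08-26; WAVE-U-MANIFEST v3.0 row «SkelFrm1ParamsLF» ↦ «SkelFrmFrom1ParamsLF») of the tree module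
# `Transplant/SkelFrm1ParamsLF` onto the carrier `PlanarSkeletonFrmFrom` (frames only, cylinders connected from width `ℓ₀` on)

ORIGINAL TITLE: N2 (frames-only node `SamePDropOfSkeletonFrmFrom₁`, OPEN) params column over `PlanarSkeletonFrm` — (ζ″) ledger, shape (B′) of record ((R-14)):

builds on p205010 (kernel theorem, internal audit signed; external expert review pending) — nothing in this file uses p205010; NOTHING is claimed about the
OPEN node U `SamePDropOfSkeletonFrmFrom₁` (nor U_s / the end state).  Lane `prim-bschramm`, seat `prim-bschramm-p3` gen 26; helper file
(`--supports stmt-CriticalPhenomena-4575 --as helper`).  PORT RULES r1–r4 of RULING D-U: declaration order and proof texts are those of the original,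
byte-identical except (i) the carrier token `PlanarSkeletonFrm ↦ PlanarSkeletonFrmFrom` (binders, `namespace`/`end` lines, qualified names of twinned
declarations), (ii) carrier-FREE declarations of the original (φ-level `Skelφ…` blocks and namespace-only arithmetic residents) are NOT re-declared —
this file imports the original and `export`s the twin-free residents (POLICY T / treatment (m1)); residents whose statement mentions a twinned
constant are copied, (iii) every carrier-binding declaration keeps its explicit binder `(Φ : PlanarSkeletonFrmFrom G)` in its own signature (r2).  Docstrings and citations are the original's.
-/

noncomputable section

open scoped Classical

namespace Summit.CriticalPhenomena.PercolationContinuityZ3.Theorems.Transplant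

namespace PlanarSkeletonFrmFrom

namespace Neg

open Literature.Probability.Percolation Literature.Probability.LatticeModels SimpleGraph
open Literature.Barriers.CriticalPhenomena (graphBall)
open SkelConc (Consts)

section LFLevel

/-! ## §1 The numeric long clause -/

/-- **The numeric part of the long pair's geometric clause** (map-free; the ℤ shapes every params fact consumes): `M_L + 1 ≤ n_L`, `M_L + 1 ≤ ℓ_L`, `|v_L| ≤ n_L`,
`(M_L+1)(n_L+|h_L|) ≤ n_L(ℓ_L+1)`. [this work] -/
structure EqNumL (κ : Consts) {V : Type} [DecidableEq V] [Countable V] {G : SimpleGraph V} [G.LocallyFinite] (Φ : PlanarSkeletonFrmFrom G) (t : V) (p : unitInterval) (D : Skelφ.StepI.DataNS V) (f : ℕ) : Prop where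
  /-- `M_L + 1 ≤ n_L` -/
  n_le : (ML κ Φ t p D : ℤ) + 1 ≤ (nL κ Φ t p D f : ℕ)
  /-- `M_L + 1 ≤ ℓ_L` -/
  ℓ_le : (ML κ Φ t p D : ℤ) + 1 ≤ (ℓL κ Φ t p D f : ℕ)
  /-- `|v_L| ≤ n_L` -/
  v_le : |vL κ Φ t p D f| ≤ (nL κ Φ t p D f : ℤ)
  /-- the zone-clearance (layer) inequality `(M_L+1)(n_L+|h_L|) ≤ n_L(ℓ_L+1)` -/
  layer : ((ML κ Φ t p D : ℤ) + 1) * ((nL κ Φ t p D f : ℤ) + |hL κ Φ t p D f|) ≤ (nL κ Φ t p D f : ℤ) * ((ℓL κ Φ t p D f : ℤ) + 1)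

export PlanarSkeletonFrm.Neg (eqGeom_num_of)

/-- **The numeric long clause from the geometric clause at the long pair, for ANY map** (`Φ.φ` with `D`, or `trφ Φ.φ` with `DT`, or the merged record with the oriented map).
[folklore] -/
theorem eqNumL_of_eqGeom (κ : Consts) {V : Type} [DecidableEq V] [Countable V] {G : SimpleGraph V} [G.LocallyFinite] (Φ : PlanarSkeletonFrmFrom G) (t : V) (p : unitInterval) (D : Skelφ.StepI.DataNS V) (f : ℕ) (ψ : V → Site 2) (hE : D.EqGeom G ψ t (ML κ Φ t p D) (nL κ Φ t p D f)) : EqNumL κ Φ t p D f := by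
  obtain ⟨h1, h2, h3, h4⟩ := eqGeom_num_of t D ψ hE
  refine ⟨?_, ?_, h3, h4⟩
  · have : ML κ Φ t p D + 1 ≤ nL κ Φ t p D f := h1
    exact_mod_cast this
  · have : ML κ Φ t p D + 1 ≤ ℓL κ Φ t p D f := h2
    exact_mod_cast this

/-- `1 ≤ n_L` and `1 ≤ ℓ_L` under the numeric long clause. [folklore] -/
theorem one_le_of_eqNumL (κ : Consts) {V : Type} [DecidableEq V] [Countable V] {G : SimpleGraph V} [G.LocallyFinite] (Φ : PlanarSkeletonFrmFrom G) (t : V) (p : unitInterval) (D : Skelφ.StepI.DataNS V) (f : ℕ) (hN : EqNumL κ Φ t p D f) : 1 ≤ nL κ Φ t p D f ∧ 1 ≤ ℓL κ Φ t p D f := by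
  obtain ⟨hn, hℓ, -, -⟩ := hN
  constructor
  · have : (1 : ℤ) ≤ nL κ Φ t p D f := by linarith
    exact_mod_cast this
  · have : (1 : ℤ) ≤ ℓL κ Φ t p D f := by linarith
    exact_mod_cast this

/-- **`δI < 1`** (the `ChoiceN.δI_lt_one` field): `δI = (δkit/4)² ≤ 1/16`. [folklore] -/
theorem δI_lt_one (κ : Consts) {V : Type} [DecidableEq V] [Countable V] {G : SimpleGraph V} [G.LocallyFinite] (Φ : PlanarSkeletonFrmFrom G) : Neg.δI κ Φ < 1 := by
  have h1 := (Neg.δI_eq κ Φ).1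
  have h2 := Neg.δkit_le_one κ Φ
  have h3 := (Neg.δkit_pos κ Φ).le
  rw [h1]
  nlinarith

/-! ## §2 The cells of record (one notch below the maximal multipliers) -/

/-- The fine multiplier of record, axis `0`: `m₀ − 1`. [this work] -/
def fm0 (κ : Consts) {V : Type} [DecidableEq V] [Countable V] {G : SimpleGraph V} [G.LocallyFinite] (Φ : PlanarSkeletonFrmFrom G) (t : V) (p : unitInterval) (D : Skelφ.StepI.DataNS V) (f : ℕ) : ℤ := m0 κ Φ t p D f - 1

/-- The fine multiplier of record, axis `1`: `m₁ − 1`. [this work] -/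
def fm1 (κ : Consts) {V : Type} [DecidableEq V] [Countable V] {G : SimpleGraph V} [G.LocallyFinite] (Φ : PlanarSkeletonFrmFrom G) (t : V) (p : unitInterval) (D : Skelφ.StepI.DataNS V) (f : ℕ) : ℤ := m1 κ Φ t p D f - 1

/-- The stub increments of record `max 1 (m_i − 1).toNat` (`= m_i − 1` under the long clause). [this work] -/
def fmNat (κ : Consts) {V : Type} [DecidableEq V] [Countable V] {G : SimpleGraph V} [G.LocallyFinite] (Φ : PlanarSkeletonFrmFrom G) (t : V) (p : unitInterval) (D : Skelφ.StepI.DataNS V) (f : ℕ) : Fin 2 → ℕ := ![max 1 (fm0 κ Φ t p D f).toNat, max 1 (fm1 κ Φ t p D f).toNat]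

/-- **THE TWO-UNIT CELLS OF RECORD** `⟨K, m − 1⟩` ((R3) with rounding room: `r_i = K·(m_i − 1)` fine units = `K` ρ-units up to one notch).
[cite: KozmaNitzan2024, §4 pp. 25–26] -/
def fcells (κ : Consts) {V : Type} [DecidableEq V] [Countable V] {G : SimpleGraph V} [G.LocallyFinite] (Φ : PlanarSkeletonFrmFrom G) (t : V) (p : unitInterval) (D : Skelφ.StepI.DataNS V) (f : ℕ) : PCells2 := ⟨Neg.K κ, fmNat κ Φ t p D f, (Neg.forty_le_K κ).2.1, fun i => by unfold fmNat; fin_cases i <;> exact le_max_left _ _⟩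

/-- The cells' `K` is `Neg.K κ` (`κ.K₀ ≤ K`) and `r_i = K·s_i`. [folklore] -/
theorem fcells_K (κ : Consts) {V : Type} [DecidableEq V] [Countable V] {G : SimpleGraph V} [G.LocallyFinite] (Φ : PlanarSkeletonFrmFrom G) (t : V) (p : unitInterval) (D : Skelφ.StepI.DataNS V) (f : ℕ) : (fcells κ Φ t p D f).K = Neg.K κ ∧ κ.K₀ ≤ (fcells κ Φ t p D f).K ∧ ∀ i, (fcells κ Φ t p D f).r i = Neg.K κ * (fcells κ Φ t p D f).s i :=
  ⟨rfl, Neg.K₀_le_K κ, fun _ => rfl⟩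

/-- The floor `4K·(R′+1) + 2 ≤ M_L` (from `4K(R′+2) ≤ M_L`, `K ≥ 1`), in `ℤ`. [folklore] -/
theorem floor_R'succ (κ : Consts) {V : Type} [DecidableEq V] [Countable V] {G : SimpleGraph V} [G.LocallyFinite] (Φ : PlanarSkeletonFrmFrom G) (t : V) (p : unitInterval) (D : Skelφ.StepI.DataNS V) : 4 * (Neg.K κ : ℤ) * ((R' κ Φ t p D : ℤ) + 1) + 2 ≤ (ML κ Φ t p D : ℤ) := by
  have h := (coarse_floor_le_ML κ Φ t p D).1
  have hK := (Neg.forty_le_K κ).2.2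
  have h' : 4 * Neg.K κ * (R' κ Φ t p D + 1) + 2 ≤ ML κ Φ t p D := by
    have e : 4 * Neg.K κ * (R' κ Φ t p D + 2) = 4 * Neg.K κ * (R' κ Φ t p D + 1) + 4 * Neg.K κ := by ring
    rw [e] at h
    omega
  exact_mod_cast h'

/-- **`R′ ≤ m_i − 1`** at the ledger's values (`le_mOf_both` at `s := R′ + 1`, floor `4K(R′+1)+2 ≤ M_L`). [this work] -/
theorem R'_le_fm_at (κ : Consts) {V : Type} [DecidableEq V] [Countable V] {G : SimpleGraph V} [G.LocallyFinite] (Φ : PlanarSkeletonFrmFrom G) (t : V) (p : unitInterval) (D : Skelφ.StepI.DataNS V) (f : ℕ) (hN : EqNumL κ Φ t p D f) : (R' κ Φ t p D : ℤ) ≤ fm0 κ Φ t p D f ∧ (R' κ Φ t p D : ℤ) ≤ fm1 κ Φ t p D f := by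
  obtain ⟨hn, hℓ, hv, hlay⟩ := hN
  have hM := floor_R'succ κ Φ t p D
  have h := Skelφ.NegPrm.le_mOf_both (s := (R' κ Φ t p D : ℤ) + 1) (Neg.forty_le_K κ).2.2 (by positivity) hM hn hℓ hlay hv
  unfold fm0 fm1 m0 m1
  constructor
  · linarith [h.1]
  · linarith [h.2]

/-- `1 ≤ m₀ − 1` and `1 ≤ m₁ − 1`. [folklore] -/
theorem one_le_fm_at (κ : Consts) {V : Type} [DecidableEq V] [Countable V] {G : SimpleGraph V} [G.LocallyFinite] (Φ : PlanarSkeletonFrmFrom G) (t : V) (p : unitInterval) (D : Skelφ.StepI.DataNS V) (f : ℕ) (hN : EqNumL κ Φ t p D f) : 1 ≤ fm0 κ Φ t p D f ∧ 1 ≤ fm1 κ Φ t p D f := by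
  have h := R'_le_fm_at κ Φ t p D f hN
  have hR : (1 : ℤ) ≤ R' κ Φ t p D := by exact_mod_cast (one_le_R' κ Φ t p D).1
  exact ⟨hR.trans h.1, hR.trans h.2⟩

/-- **The stub increments ARE `m_i − 1`** under the long clause. [folklore] -/
theorem fcells_s_at (κ : Consts) {V : Type} [DecidableEq V] [Countable V] {G : SimpleGraph V} [G.LocallyFinite] (Φ : PlanarSkeletonFrmFrom G) (t : V) (p : unitInterval) (D : Skelφ.StepI.DataNS V) (f : ℕ) (hN : EqNumL κ Φ t p D f) :
    (((fcells κ Φ t p D f).s 0 : ℕ) : ℤ) = fm0 κ Φ t p D f ∧ (((fcells κ Φ t p D f).s 1 : ℕ) : ℤ) = fm1 κ Φ t p D f := by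
  obtain ⟨h0, h1⟩ := one_le_fm_at κ Φ t p D f hN
  have e0 : (fcells κ Φ t p D f).s 0 = max 1 (fm0 κ Φ t p D f).toNat := rfl
  have e1 : (fcells κ Φ t p D f).s 1 = max 1 (fm1 κ Φ t p D f).toNat := rfl
  rw [e0, e1]
  constructor
  · rw [max_eq_right (by omega), Int.toNat_of_nonneg (by omega)]
  · rw [max_eq_right (by omega), Int.toNat_of_nonneg (by omega)]

export PlanarSkeletonNeg.Neg (one_le_L0)

/-- **The resolution inequalities `c_i·L_i ≤ D` for the cells of record** (`c_i = 20K·(m_i − 1) ≤ 20K·m_i`). [folklore] -/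
theorem cL_le_D_fcells_at (κ : Consts) {V : Type} [DecidableEq V] [Countable V] {G : SimpleGraph V} [G.LocallyFinite] (Φ : PlanarSkeletonFrmFrom G) (t : V) (p : unitInterval) (D : Skelφ.StepI.DataNS V) (f : ℕ) (hN : EqNumL κ Φ t p D f) :
    20 * ((fcells κ Φ t p D f).K : ℤ) * (((fcells κ Φ t p D f).s 0 : ℕ) : ℤ) * (|(800 : ℤ)| * (|vβL κ Φ t p D f| + |vL κ Φ t p D f|)) ≤
        Skelφ.NegPrm.Dof (nL κ Φ t p D f) (hL κ Φ t p D f) (ℓL κ Φ t p D f) (vL κ Φ t p D f) ∧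
      20 * ((fcells κ Φ t p D f).K : ℤ) * (((fcells κ Φ t p D f).s 1 : ℕ) : ℤ) * (|(800 : ℤ)| * (|(nL κ Φ t p D f : ℤ)| + |hL κ Φ t p D f|)) ≤
        Skelφ.NegPrm.Dof (nL κ Φ t p D f) (hL κ Φ t p D f) (ℓL κ Φ t p D f) (vL κ Φ t p D f) := by
  obtain ⟨hn1, hℓ1⟩ := one_le_of_eqNumL κ Φ t p D f hN
  obtain ⟨e0, e1⟩ := fcells_s_at κ Φ t p D f hN
  have hK : (0 : ℤ) ≤ (Neg.K κ : ℤ) := by positivity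
  have c0 := Skelφ.NegPrm.cL_le_D₀ (K := Neg.K κ) hn1 hℓ1 (hL κ Φ t p D f) (vL κ Φ t p D f)
  have c1 := Skelφ.NegPrm.cL_le_D₁ (K := Neg.K κ) hn1 hℓ1 (hL κ Φ t p D f) (vL κ Φ t p D f)
  rw [(fcells_K κ Φ t p D f).1, e0, e1]
  have X0 : (0 : ℤ) ≤ |(800 : ℤ)| * (|vβL κ Φ t p D f| + |vL κ Φ t p D f|) := by positivity
  have X1 : (0 : ℤ) ≤ |(800 : ℤ)| * (|(nL κ Φ t p D f : ℤ)| + |hL κ Φ t p D f|) := by positivity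
  unfold fm0 fm1 m0 m1
  unfold vβL at X0 ⊢
  constructor
  · nlinarith [c0, mul_nonneg hK X0]
  · nlinarith [c1, mul_nonneg hK X1]

/-- **THE ROUNDING ROOM `c_i·L_i + 2 ≤ D` of the cells of record** (one notch: `20K(m_i − 1)·800L̂_i + 16000·K·L̂_i ≤ D`, `L̂_i ≥ 1`, `K ≥ 1`) — the hypothesis of
`fine_rep` / `exists_mem_graphBall_fineSkel_eq` / `hcol_fineSkel`. [this work] -/
theorem room_fcells_at (κ : Consts) {V : Type} [DecidableEq V] [Countable V] {G : SimpleGraph V} [G.LocallyFinite] (Φ : PlanarSkeletonFrmFrom G) (t : V) (p : unitInterval) (D : Skelφ.StepI.DataNS V) (f : ℕ) (hN : EqNumL κ Φ t p D f) :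
    20 * ((fcells κ Φ t p D f).K : ℤ) * (((fcells κ Φ t p D f).s 0 : ℕ) : ℤ) * (|(800 : ℤ)| * (|vβL κ Φ t p D f| + |vL κ Φ t p D f|)) + 2 ≤
        Skelφ.NegPrm.Dof (nL κ Φ t p D f) (hL κ Φ t p D f) (ℓL κ Φ t p D f) (vL κ Φ t p D f) ∧
      20 * ((fcells κ Φ t p D f).K : ℤ) * (((fcells κ Φ t p D f).s 1 : ℕ) : ℤ) * (|(800 : ℤ)| * (|(nL κ Φ t p D f : ℤ)| + |hL κ Φ t p D f|)) + 2 ≤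
        Skelφ.NegPrm.Dof (nL κ Φ t p D f) (hL κ Φ t p D f) (ℓL κ Φ t p D f) (vL κ Φ t p D f) := by
  obtain ⟨hn1, hℓ1⟩ := one_le_of_eqNumL κ Φ t p D f hN
  obtain ⟨e0, e1⟩ := fcells_s_at κ Φ t p D f hN
  have hK : (1 : ℤ) ≤ (Neg.K κ : ℤ) := by exact_mod_cast (Neg.forty_le_K κ).2.2
  have c0 := Skelφ.NegPrm.cL_le_D₀ (K := Neg.K κ) hn1 hℓ1 (hL κ Φ t p D f) (vL κ Φ t p D f)
  have c1 := Skelφ.NegPrm.cL_le_D₁ (K := Neg.K κ) hn1 hℓ1 (hL κ Φ t p D f) (vL κ Φ t p D f)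
  rw [(fcells_K κ Φ t p D f).1, e0, e1]
  have e8 : |(800 : ℤ)| = 800 := abs_of_nonneg (by norm_num)
  have hL0 : (1 : ℤ) ≤ |vβL κ Φ t p D f| + |vL κ Φ t p D f| := one_le_L0 hn1 hℓ1 _ _
  have hL1 : (1 : ℤ) ≤ |(nL κ Φ t p D f : ℤ)| + |hL κ Φ t p D f| := by
    rw [abs_of_nonneg (by positivity : (0 : ℤ) ≤ (nL κ Φ t p D f : ℤ))]
    have : (1 : ℤ) ≤ nL κ Φ t p D f := by exact_mod_cast hn1
    linarith [abs_nonneg (hL κ Φ t p D f)]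
  rw [e8] at c0 c1 ⊢
  unfold fm0 fm1 m0 m1
  unfold vβL at hL0 ⊢
  constructor
  · nlinarith [c0, hL0, hK]
  · nlinarith [c1, hL1, hK]

/-! ## §3 The fine window map at the ledger's values (map slot `φ′`) -/

/-- **THE FINE WINDOW MAP OF N1 AT THE LEDGER'S VALUES**, planar map a slot: `fine φ′ := NegPrm.fine φ′ t fcells n_L h_L ℓ_L v_L` (instantiate `φ′ := Φ.φ` in orientation
`true`, `φ′ := trφ Φ.φ` in orientation `false`). [this work] -/
def fine (κ : Consts) {V : Type} [DecidableEq V] [Countable V] {G : SimpleGraph V} [G.LocallyFinite] (Φ : PlanarSkeletonFrmFrom G) (t : V) (p : unitInterval) (D : Skelφ.StepI.DataNS V) (f : ℕ) (φ' : V → Site 2) : V → Site 2 :=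
  Skelφ.NegPrm.fine φ' t (fcells κ Φ t p D f) (nL κ Φ t p D f) (hL κ Φ t p D f) (ℓL κ Φ t p D f) (vL κ Φ t p D f)

/-- `fine` unfolded. [folklore] -/
theorem fine_eq (κ : Consts) {V : Type} [DecidableEq V] [Countable V] {G : SimpleGraph V} [G.LocallyFinite] (Φ : PlanarSkeletonFrmFrom G) (t : V) (p : unitInterval) (D : Skelφ.StepI.DataNS V) (f : ℕ) (φ' : V → Site 2) :
    fine κ Φ t p D f φ' = Skelφ.NegPrm.fine φ' t (fcells κ Φ t p D f) (nL κ Φ t p D f) (hL κ Φ t p D f) (ℓL κ Φ t p D f) (vL κ Φ t p D f) := rfl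

/-- **BASE POINT** (`hψ0` of `sepGeomSG₂` at `w₀ = t`): `fine φ′ t = 0`. [folklore] -/
theorem fine_base_at (κ : Consts) {V : Type} [DecidableEq V] [Countable V] {G : SimpleGraph V} [G.LocallyFinite] (Φ : PlanarSkeletonFrmFrom G) (t : V) (p : unitInterval) (D : Skelφ.StepI.DataNS V) (f : ℕ) (φ' : V → Site 2) (hN : EqNumL κ Φ t p D f) : fine κ Φ t p D f φ' t = 0 := by
  obtain ⟨hn1, hℓ1⟩ := one_le_of_eqNumL κ Φ t p D f hN
  exact Skelφ.NegPrm.fine_base φ' t _ hn1 hℓ1 _ _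

/-- **`hlip`**: the fine map is 1-Lipschitz for a 1-Lipschitz `φ′`. [cite: MartineauTassion2017, §4.3] -/
theorem lip_fine_at (κ : Consts) {V : Type} [DecidableEq V] [Countable V] {G : SimpleGraph V} [G.LocallyFinite] (Φ : PlanarSkeletonFrmFrom G) (t : V) (p : unitInterval) (D : Skelφ.StepI.DataNS V) (f : ℕ) {φ' : V → Site 2} (hlip : Skelφ.Lip G φ') (hN : EqNumL κ Φ t p D f) : Skelφ.Lip G (fine κ Φ t p D f φ') := by
  obtain ⟨hn1, hℓ1⟩ := one_le_of_eqNumL κ Φ t p D f hN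
  obtain ⟨c0, c1⟩ := cL_le_D_fcells_at κ Φ t p D f hN
  exact Skelφ.NegPrm.lip_fine hlip t _ hn1 hℓ1 c0 c1

/-- **`hws`**: the fine map has weak steps for a unit-step `φ′`. [this work] -/
theorem weakSteps_fine_at (κ : Consts) {V : Type} [DecidableEq V] [Countable V] {G : SimpleGraph V} [G.LocallyFinite] (Φ : PlanarSkeletonFrmFrom G) (t : V) (p : unitInterval) (D : Skelφ.StepI.DataNS V) (f : ℕ) {φ' : V → Site 2} (hstep : Skelφ.Steps G φ') (hN : EqNumL κ Φ t p D f) : Skelφ.WeakSteps G (fine κ Φ t p D f φ') := by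
  obtain ⟨hn1, hℓ1⟩ := one_le_of_eqNumL κ Φ t p D f hN
  exact Skelφ.NegPrm.weakSteps_fine hstep t _ hn1 hℓ1 _ _

/-- **KIT DRIFT READS AS AT MOST `R′` FINE UNITS** (inside one stub increment `m_i − 1 ≥ R′`). [cite: KozmaNitzan2024, §4 Lemma 10 Step IV] -/
theorem fine_drift_at (κ : Consts) {V : Type} [DecidableEq V] [Countable V] {G : SimpleGraph V} [G.LocallyFinite] (Φ : PlanarSkeletonFrmFrom G) (t : V) (p : unitInterval) (D : Skelφ.StepI.DataNS V) (f : ℕ) (hN : EqNumL κ Φ t p D f) {φ' : V → Site 2} {w w' : V} (h0 : |φ' w 0 - φ' w' 0| ≤ (R' κ Φ t p D : ℤ))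
    (h1 : |φ' w 1 - φ' w' 1| ≤ (R' κ Φ t p D : ℤ)) (i : Fin 2) : |fine κ Φ t p D f φ' w i - fine κ Φ t p D f φ' w' i| ≤ (R' κ Φ t p D : ℤ) := by
  obtain ⟨hn1, hℓ1⟩ := one_le_of_eqNumL κ Φ t p D f hN
  obtain ⟨c0, c1⟩ := cL_le_D_fcells_at κ Φ t p D f hN
  exact Skelφ.NegPrm.fine_drift_le t _ hn1 hℓ1 c0 c1 (by positivity) h0 h1 i

/-- **A FINE BOX IS A φ′-BOX**: `|Δ fine|_∞ ≤ r ⇒ K·|Δφ′_i| ≤ 80·(n_L + ℓ_L + 3|h_L| + 1)·(r + 1)`. [cite: KozmaNitzan2024, §4 Lemma 12 (p. 24)] -/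
theorem φ_extent_fine_at (κ : Consts) {V : Type} [DecidableEq V] [Countable V] {G : SimpleGraph V} [G.LocallyFinite] (Φ : PlanarSkeletonFrmFrom G) (t : V) (p : unitInterval) (D : Skelφ.StepI.DataNS V) (f : ℕ) (hN : EqNumL κ Φ t p D f) {φ' : V → Site 2} {w w' : V} {r : ℤ} (hr : 0 ≤ r)
    (hρ : ∀ i, |fine κ Φ t p D f φ' w i - fine κ Φ t p D f φ' w' i| ≤ r) (i : Fin 2) :
    (Neg.K κ : ℤ) * |φ' w i - φ' w' i| ≤ 80 * ((nL κ Φ t p D f : ℤ) + ℓL κ Φ t p D f + 3 * |hL κ Φ t p D f| + 1) * (r + 1) := by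
  obtain ⟨hn1, hℓ1⟩ := one_le_of_eqNumL κ Φ t p D f hN
  obtain ⟨-, -, hv, -⟩ := hN
  exact Skelφ.NegPrm.φ_extent_of_fine_extent t _ hn1 hℓ1 _ hv hr hρ i

/-! ## §4 The column radius, FINE STEPS, and the column point `hcol` -/

/-- **The column radius of record** `Nrep z := ‖rep₂ z‖₁` — the graph distance from `t` within which a vertex of fine position `z` exists (hp-8's canonical representative
`rep₂` of the fine cell `z`, resolutions `c_i = 20K·(m_i − 1)`); the `colQ`/`Nrep` slot of the schedule reads `Nrep (cen x) + 1 ≤ rQ a x`. [this work] -/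
def Nrep (κ : Consts) {V : Type} [DecidableEq V] [Countable V] {G : SimpleGraph V} [G.LocallyFinite] (Φ : PlanarSkeletonFrmFrom G) (t : V) (p : unitInterval) (D : Skelφ.StepI.DataNS V) (f : ℕ) (z : Site 2) : ℕ :=
  (TwoAxis.Para.rep₂ 800 (nL κ Φ t p D f) (hL κ Φ t p D f) (vL κ Φ t p D f) (vβL κ Φ t p D f)
      (20 * ((fcells κ Φ t p D f).K : ℤ) * (((fcells κ Φ t p D f).s 0 : ℕ) : ℤ)) (20 * ((fcells κ Φ t p D f).K : ℤ) * (((fcells κ Φ t p D f).s 1 : ℕ) : ℤ)) z 0).natAbs +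
    (TwoAxis.Para.rep₂ 800 (nL κ Φ t p D f) (hL κ Φ t p D f) (vL κ Φ t p D f) (vβL κ Φ t p D f)
      (20 * ((fcells κ Φ t p D f).K : ℤ) * (((fcells κ Φ t p D f).s 0 : ℕ) : ℤ)) (20 * ((fcells κ Φ t p D f).K : ℤ) * (((fcells κ Φ t p D f).s 1 : ℕ) : ℤ)) z 1).natAbs

/-- The resolutions of the cells of record are positive. [folklore] -/
theorem c_pos (κ : Consts) {V : Type} [DecidableEq V] [Countable V] {G : SimpleGraph V} [G.LocallyFinite] (Φ : PlanarSkeletonFrmFrom G) (t : V) (p : unitInterval) (D : Skelφ.StepI.DataNS V) (f : ℕ) (i : Fin 2) : (0 : ℤ) < 20 * ((fcells κ Φ t p D f).K : ℤ) * (((fcells κ Φ t p D f).s i : ℕ) : ℤ) := by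
  have hK : (1 : ℤ) ≤ ((fcells κ Φ t p D f).K : ℤ) := by rw [(fcells_K κ Φ t p D f).1]; exact_mod_cast (Neg.forty_le_K κ).2.2
  have hs : (1 : ℤ) ≤ (((fcells κ Φ t p D f).s i : ℕ) : ℤ) := by exact_mod_cast (fcells κ Φ t p D f).hs i
  nlinarith

/-- **FINE STEPS**: from `t`, for every fine position `z`, a vertex `g` with `fine φ′ g = z` within graph distance `Nrep z` (unit steps of `φ′`, the rounding room of
`fcells`). [cite: KozmaNitzan2024, §4 Lemma 10 Step IV (pp. 20–21)] -/
theorem exists_fine_eq_at (κ : Consts) {V : Type} [DecidableEq V] [Countable V] {G : SimpleGraph V} [G.LocallyFinite] (Φ : PlanarSkeletonFrmFrom G) (t : V) (p : unitInterval) (D : Skelφ.StepI.DataNS V) (f : ℕ) {φ' : V → Site 2} (hstep : Skelφ.Steps G φ') (hN : EqNumL κ Φ t p D f) (z : Site 2) :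
    ∃ g, g ∈ graphBall G t (Nrep κ Φ t p D f z) ∧ fine κ Φ t p D f φ' g = z := by
  obtain ⟨hn1, hℓ1⟩ := one_le_of_eqNumL κ Φ t p D f hN
  obtain ⟨r0, r1⟩ := room_fcells_at κ Φ t p D f hN
  have hD := Skelφ.NegPrm.Dof_pos hn1 hℓ1 (hL κ Φ t p D f) (vL κ Φ t p D f)
  obtain ⟨g, hg, hgz⟩ := Skelφ.exists_mem_graphBall_fineSkel_eq (A := 800) (n := (nL κ Φ t p D f : ℤ)) (h := hL κ Φ t p D f) (vα := vL κ Φ t p D f)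
    (vβ := vβL κ Φ t p D f) hstep t (c_pos κ Φ t p D f 0) (c_pos κ Φ t p D f 1) hD r0 r1 z
  exact ⟨g, hg, hgz⟩

/-- **THE COLUMN POINT `hcol` of `sepGeomSG₂`** for the fine map of record: for every cube `Q x` of `fcells` and every radius `R ≥ Nrep (cen x) + 1`, a vertex of fine position
exactly `cen x` inside the window span `VWin (Q x) R` (`Lip` + `Steps` of `φ′`). [cite: KozmaNitzan2024, §4 p. 26 ((29): columns)] -/
theorem hcol_fine_at (κ : Consts) {V : Type} [DecidableEq V] [Countable V] {G : SimpleGraph V} [G.LocallyFinite] (Φ : PlanarSkeletonFrmFrom G) (t : V) (p : unitInterval) (D : Skelφ.StepI.DataNS V) (f : ℕ) {φ' : V → Site 2} (hlip : Skelφ.Lip G φ') (hstep : Skelφ.Steps G φ') (hN : EqNumL κ Φ t p D f) (x : Site 2) {R : ℕ}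
    (hR : Nrep κ Φ t p D f ((fcells κ Φ t p D f).cen x) + 1 ≤ R) :
    ∃ y ∈ Skelφ.VWin G (fine κ Φ t p D f φ') t ((fcells κ Φ t p D f).Q x) R, fine κ Φ t p D f φ' y = (fcells κ Φ t p D f).cen x := by
  obtain ⟨hn1, hℓ1⟩ := one_le_of_eqNumL κ Φ t p D f hN
  obtain ⟨r0, r1⟩ := room_fcells_at κ Φ t p D f hN
  have hD := Skelφ.NegPrm.Dof_pos hn1 hℓ1 (hL κ Φ t p D f) (vL κ Φ t p D f)
  exact Skelφ.hcol_fineSkel (A := 800) (n := (nL κ Φ t p D f : ℤ)) (h := hL κ Φ t p D f) (vα := vL κ Φ t p D f) (vβ := vβL κ Φ t p D f) hlip hstep t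
    (c_pos κ Φ t p D f 0) (c_pos κ Φ t p D f 1) hD r0 r1 (fcells κ Φ t p D f) x hR

/-- **`hcol` in the shape `sepGeomSG₂` consumes** (`∀ a x, ∃ y ∈ VWin … (Q x) (Λ.rQ a x), fine y = cen x`) from a schedule whose cube radii dominate the column radius.
[folklore] -/
theorem hcol_fine_of_sched (κ : Consts) {V : Type} [DecidableEq V] [Countable V] {G : SimpleGraph V} [G.LocallyFinite] (Φ : PlanarSkeletonFrmFrom G) (t : V) (p : unitInterval) (D : Skelφ.StepI.DataNS V) (f : ℕ) {φ' : V → Site 2} (hlip : Skelφ.Lip G φ') (hstep : Skelφ.Steps G φ') (hN : EqNumL κ Φ t p D f) {Λ : BoxProdZ2.ConcRadiiG}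
    (hcolQ : ∀ a x, Nrep κ Φ t p D f ((fcells κ Φ t p D f).cen x) + 1 ≤ Λ.rQ a x) :
    ∀ a x, ∃ y ∈ Skelφ.VWin G (fine κ Φ t p D f φ') t ((fcells κ Φ t p D f).Q x) (Λ.rQ a x), fine κ Φ t p D f φ' y = (fcells κ Φ t p D f).cen x :=
  fun a x => hcol_fine_at κ Φ t p D f hlip hstep hN x (hcolQ a x)

end LFLevel

end Neg

end PlanarSkeletonFrmFrom

end Summit.CriticalPhenomena.PercolationContinuityZ3.Theorems.Transplant

end
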